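import Literature.IUT.HodgeArakelov.GMonoidFrobenioidsGaussian
import HarnessLib

/-!
# [IUTchII] Corollary 3.5 (ii) / 3.7 (i) — proof companion of `GMonoidFrobenioidsGaussian.lean`: stability and transport
# lemmas for the Gaussian `G`-monoids along isomorphisms of pairs

S. Mochizuki, *Inter-universal Teichmüller theory II*, §3, kurims manuscript (Dec. 2020): Corollary 3.5 (ii) p. 95 l. 11–14
«each `Ψ_ξ(M^Θ_*)` is equipped with a natural action by `G_v(M^Θ_*▶)_⟨F_l^⋇⟩`» (likewise `∞Ψ_ξ`, `Ψ_{2l·ξ}`)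
[cite: Mochizuki2012, Cor 3.5 (ii) p.95]; Corollary 3.6 (i) p. 99 (the labelled Kummer copies `(Ψ_{†C_v})_t ⥲ Ψ_cns(M^Θ_*)_t`
compatible with `G_v(M^Θ_*)_t ⥲ G_v(M^Θ_*▶)_t`); Corollary 3.7 (i) p. 111 l. 21 – p. 112 l. 6 «compatible [in the evident
sense] collections of isomorphisms … `Ψ_ξ(M^Θ_*(Π_v)) ⥲ Ψ_ξ(M^Θ_*(†F_v)) ⥲ Ψ_{F_ξ}(†F_v)`» [cite: Mochizuki2012, Cor 3.7 (i) p.111].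
Claim key DISPUTED (D-0012): nothing of [IUTchII] is asserted.

abc-iut cell, layer L6, MERGE-MAP row **R-Def38-a**, item «GAUSSIAN-FRD», seat abc-iut-L6-t7 gen 6.  PROOF-ONLY companion (0
`def`/`structure`/`instance`, no new `Prop` fact) of the def-bearing `GMonoidFrobenioidsGaussian.lean` (`diagonalAct`,
`gaussianCovering`, `inftyGaussianCovering`, `Fgau`, `FFgau`, `gaussianMonoidIso`, `fgauMapOfPairIso`, `fgauToFFgau`): the
theorems that discharge the INPUTS of those constructions —
* `map_piIso_inftyGaussianMonoid_of_fixed`, `…2l…`, `inftyGaussianMonoid_diagonalStable_of_fixed`, `gaussianMonoid2l_diagonalStable_of_fixed`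
  — the stability input `hS` of `inftyGaussianCovering` (and of a `Ψ_{2l·ξ}`-version) for a value-profile fixed label by
  label (w4-d019's `map_piIso_inftyGaussianMonoid / …2l` BY NAME);
* `gaussianMonoid_diagonalStable_transport` — the stability input `hS'` of `fgauMapOfPairIso` from `hS` along a pair isomorphism
  `(σ, m)` with `σ` surjective; `fixed_transport` — a fixed value-profile transports to a fixed one (so the [FrdI] Thm 5.2
  hypotheses of `GMonoidFrobenioidsGaussianProofs` transport to `F_{m∘ξ}`, `F_{F_ξ}`);
* `symm_equivariant_of_equivariant` — the equivariance input `he` of `fgauToFFgau` from the one print states for `e` (Cor 3.6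
  (i), w4-d019's `hequiv` shape) read through `σ⁻¹`;
* `coe_gaussianMonoidIso_symm`, `degFr_fgauMapOfPairIso_map` — bookkeeping (`(piIso m)⁻¹ = piIso m⁻¹`; Frobenius degrees
  are preserved).
The Frobenioid-level compatibility SQUARES of Cor 3.5/3.6 in composites (row «COR37i-FRD-SQUARES») are NOT here.  No side taken
on [IUTchIII] Cor 3.12; typed ≠ proved; nothing asserts abc proved or refuted.
-/

namespace Literature.IUT.HodgeArakelov

namespace BadPrimeGaussianMonoids

open CategoryTheory Opposite Function
open Literature.AlgebraicGeometry.Frobenioids Literature.AnabelianGeometry.SemiGraphs TemperedThetaMonoids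

universe u v w

/-! ### Stability and transport lemmas -/

section Transport

variable {T : Type w} {M : Type v} [CommMonoid M] {M' : Type v} [CommMonoid M'] {G : Type u} [Group G] {G' : Type u} [Group G']
  (β : G →* MulAut M) (β' : G' →* MulAut M')

/-- `∞`-version of `map_piIso_gaussianMonoid_of_fixed`: `φ(∞Ψ_ξ) = ∞Ψ_ξ` for `φ` fixing the value-profile label by label
(w4-d019's `map_piIso_inftyGaussianMonoid`). [cite: Mochizuki2012, Cor 3.5 (ii) p.95] -/
theorem map_piIso_inftyGaussianMonoid_of_fixed (φ : M ≃* M) {ξ : T → M} (hξ : ∀ t, φ (ξ t) = ξ t) :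
    (inftyGaussianMonoid ξ).map (piIso T φ).toMonoidHom = inftyGaussianMonoid ξ := by
  rw [map_piIso_inftyGaussianMonoid]
  exact congrArg inftyGaussianMonoid (funext hξ)

/-- `2l`-version: `φ(Ψ_{2l·ξ}) = Ψ_{2l·ξ}` (w4-d019's `map_piIso_gaussianMonoid2l`). [cite: Mochizuki2012, Cor 3.5 (ii) p.95] -/
theorem map_piIso_gaussianMonoid2l_of_fixed (twoL : ℕ) (φ : M ≃* M) {ξ : T → M} (hξ : ∀ t, φ (ξ t) = ξ t) :
    (gaussianMonoid2l twoL ξ).map (piIso T φ).toMonoidHom = gaussianMonoid2l twoL ξ := by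
  rw [map_piIso_gaussianMonoid2l]
  exact congrArg (gaussianMonoid2l twoL) (funext hξ)

/-- «each `∞Ψ_ξ(M^Θ_*)` is equipped with a natural action by `G_v(M^Θ_*▶)_⟨F_l^⋇⟩`», pointwise: `∞Ψ_ξ` is stable under the diagonal
action for a value-profile fixed label by label. [cite: Mochizuki2012, Cor 3.5 (ii) p.95] -/
theorem inftyGaussianMonoid_diagonalStable_of_fixed {ξ : T → M} (hξ : ∀ (g : G) (t : T), β g (ξ t) = ξ t) :
    ∀ (g : G) (y : T → M), y ∈ inftyGaussianMonoid ξ → piIso T (β g) y ∈ inftyGaussianMonoid ξ :=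
  fun g _ hy => mem_of_map_piIso_eq (map_piIso_inftyGaussianMonoid_of_fixed (β g) (hξ g)) hy

/-- `Ψ_{2l·ξ}` is stable under the diagonal action for a value-profile fixed label by label. [cite: Mochizuki2012, Cor 3.5 (ii) p.95] -/
theorem gaussianMonoid2l_diagonalStable_of_fixed (twoL : ℕ) {ξ : T → M} (hξ : ∀ (g : G) (t : T), β g (ξ t) = ξ t) :
    ∀ (g : G) (y : T → M), y ∈ gaussianMonoid2l twoL ξ → piIso T (β g) y ∈ gaussianMonoid2l twoL ξ :=
  fun g _ hy => mem_of_map_piIso_eq (map_piIso_gaussianMonoid2l_of_fixed twoL (β g) (hξ g)) hy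

/-- **Transported stability** (Cor 3.7 (i) «compatible collections»): if `m : Ψ ⥲ Ψ'` intertwines the actions through a
SURJECTION `σ : G → G'` and `Ψ_ξ` is stable under the diagonal `G`-action, then `Ψ_{m∘ξ}` is stable under the diagonal
`G'`-action — the input `hS'` of `fgauMapOfPairIso`, discharged. [cite: Mochizuki2012, Cor 3.7 (i) p.111] -/
theorem gaussianMonoid_diagonalStable_transport {σ : G → G'} (hσ : Surjective σ) (m : M ≃* M')
    (hm : ∀ (g : G) (y : M), m (β g y) = β' (σ g) (m y)) {ξ : T → M}
    (hS : ∀ (g : G) (y : T → M), y ∈ gaussianMonoid ξ → piIso T (β g) y ∈ gaussianMonoid ξ) :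
    ∀ (g' : G') (y' : T → M'), y' ∈ gaussianMonoid (fun t => m (ξ t)) →
      piIso T (β' g') y' ∈ gaussianMonoid (fun t => m (ξ t)) := by
  intro g' y' hy'
  obtain ⟨g, rfl⟩ := hσ g'
  rw [← map_piIso_gaussianMonoid] at hy' ⊢
  obtain ⟨y, hy, rfl⟩ := hy'
  refine ⟨piIso T (β g) y, hS g y hy, ?_⟩
  change piIso T m (piIso T (β g) y) = piIso T (β' (σ g)) (piIso T m y)
  exact piIso_diagonalAction_compat σ (fun g => β g) (fun g' => β' g') m hm g y

/-- A fixed value-profile transports to a fixed value-profile. [cite: Mochizuki2012, Cor 3.7 (i) p.111] -/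
theorem fixed_transport {σ : G → G'} (hσ : Surjective σ) (m : M ≃* M')
    (hm : ∀ (g : G) (y : M), m (β g y) = β' (σ g) (m y)) {ξ : T → M} (hξ : ∀ (g : G) (t : T), β g (ξ t) = ξ t)
    (g' : G') (t : T) : β' g' (m (ξ t)) = m (ξ t) := by
  obtain ⟨g, rfl⟩ := hσ g'
  rw [← hm, hξ]

/-- `(gaussianMonoidIso m ξ)⁻¹` is `piIso T m⁻¹` on underlying families. [cite: Mochizuki2012, Cor 3.7 (i) p.111] -/
@[simp] theorem coe_gaussianMonoidIso_symm (m : M ≃* M') (ξ : T → M) (y : gaussianMonoid (fun t => m (ξ t))) :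
    (((gaussianMonoidIso m ξ).symm y : gaussianMonoid ξ) : T → M) = piIso T m.symm y := rfl

variable [TopologicalSpace G] [TopologicalSpace G']

/-- `fgauMapOfPairIso` preserves Frobenius degrees (it is `(d, f, Div, u) ↦ (d, pull f, η Div, (piIso m)^gp u)`).
[cite: Mochizuki2012, Cor 3.7 (i) p.111] -/
theorem degFr_fgauMapOfPairIso_map (σ : G ≃ₜ* G') (m : M ≃* M') (hm : ∀ (g : G) (y : M), m (β g y) = β' (σ g) (m y))
    (ξ : T → M) (hS : ∀ (g : G) (y : T → M), y ∈ gaussianMonoid ξ → piIso T (β g) y ∈ gaussianMonoid ξ)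
    (hS' : ∀ (g' : G') (y' : T → M'), y' ∈ gaussianMonoid (fun t => m (ξ t)) →
      piIso T (β' g') y' ∈ gaussianMonoid (fun t => m (ξ t))) {X Y : Fgau β ξ hS} (f : X ⟶ Y) :
    ModelFrobenioid.degFr ((fgauMapOfPairIso β β' σ m hm ξ hS hS').map f) = ModelFrobenioid.degFr f := rfl

/-- The equivariance input `he` of `fgauToFFgau` from the one print states for `e` itself (Cor 3.6 (i) «compatible morphisms
`G_v(M^Θ_*)_t ⥲ G_v(M^Θ_*▶)_t ↷ (Ψ_{†C_v})_t ⥲ Ψ_cns(M^Θ_*)_t`»; w4-d019's `hequiv` shape, read through `σ⁻¹`).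
[cite: Mochizuki2012, Cor 3.6 (i) p.99] -/
theorem symm_equivariant_of_equivariant {N : Type v} [CommMonoid N] (γ : G' →* MulAut N) (e : N ≃* M) (σ : G ≃ₜ* G')
    (hequiv : ∀ (g' : G') (n : N), e (γ g' n) = β (σ.symm g') (e n)) (g : G) (y : M) :
    e.symm (β g y) = γ (σ g) (e.symm y) := by
  apply e.injective
  rw [e.apply_symm_apply, hequiv, ContinuousMulEquiv.symm_apply_apply, e.apply_symm_apply]

end Transport

end BadPrimeGaussianMonoids

end Literature.IUT.HodgeArakelov
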